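import Mathlib
import Literature.Analysis.Complex.SimilarityApproximants
import Literature.Analysis.Complex.ArgumentPrincipleWinding
import Literature.Analysis.Complex.Montel
import Literature.Topology.PlaneTopology.WindingNumber
import HarnessLib

/-!
# The similarity principle (Carleman–Bers–Vekua), smooth `δ`-regularised form

Let `w : ℂ → ℂ` be smooth with `∂̄ w = r` and `‖r‖ ≤ M ‖w‖` on the closed disc `‖z‖ ≤ ρ`
(`∂̄ = Literature.Analysis.Complex.dbarAlong 1`). The **similarity principle** (T. Carleman 1933,
L. Bers 1953, I. N. Vekua 1962; Wendl (2020), App. B Thm B.20 / Cor B.21; McDuff–Salamon (2012),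
§2.3) says that `w = Φ h` locally with `h` holomorphic and `Φ` continuous and invertible, so that
`w` behaves like a holomorphic function: its zeros are isolated (unless `w ≡ 0`) and of positive
index. We record it in the following COMPARISON FORM, which is what the applications consume and
which is proved entirely inside `C^∞` (no Sobolev spaces):

* `similarity_comparison` — for every `ρ' < ρ` there are `S : ℝ` and `H` holomorphic on
  `‖z‖ < ρ'` with the two-sided bound `e^{-S} ‖w z‖ ≤ ‖H z‖ ≤ e^{S} ‖w z‖` there, and such that
  `w` and `H` have the same winding number along every circle `‖z - z₀‖ = ε` in that disc on
  which `w` has no zero. (So `w` and `H` have the same zeros, and the same local indices.)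
* `similarity_wind_pos` — if `w z₀ = 0` and `w` is zero-free on a circle `‖z - z₀‖ = ε` inside
  the disc, then `0 < wind (w ∘ circleLoop z₀ ε)` (positivity of the index);
  `similarity_wind_nonneg`: `0 ≤ wind` along any zero-free circle.
* `similarity_isolated_zero` — if `w z₀ = 0` (`‖z₀‖ < ρ`) and `w` is not identically zero on the
  open disc, there is a small zero-free punctured closed disc `0 < ‖z - z₀‖ ≤ ε` about `z₀`, and
  the winding number of `w` along its boundary circle is `> 0`.

Proof (the `δ`-regularisation + Montel device; helpers in namespace `Similarity`,
`Literature/Analysis/Complex/SimilarityApproximants.lean`). Localise the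
coefficient with a cut-off `χ` (`= 1` on `‖η‖ ≤ ρ''`, supported in `‖η‖ < ρ`): `r̃ = χ r`
satisfies `‖r̃‖ ≤ M ‖w‖` everywhere. For `δ = t² > 0` the regularised coefficient
`a = r̃ w̄ / (|w|² + δ)` (`‖a‖ ≤ M`, `‖r̃ - a w‖ ≤ M t / 2`,
`Literature/Analysis/Complex/SimilarityRegularisation.lean`) has a smooth Cauchy transform `s`
(`∂̄ s = a`, `‖s‖ ≤ S`), and `h = e^{-s} w` satisfies `‖∂̄ h‖ = ‖e^{-s} (r - a w)‖ ≤ e^S M t / 2`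
on `‖η‖ ≤ ρ''`, so (`ApproximateHolomorphy.lean`) there is `H_t` holomorphic on `‖η‖ < ρ'` with
`‖h - H_t‖ ≤ C e^S M t / 2` on `‖η‖ ≤ ρ'`. The family `(H_t)` is uniformly bounded; by Montel
(`Literature.Analysis.Complex.Montel`) a subsequence `t → 0` converges locally uniformly to a
holomorphic `H` with `e^{-S} ‖w‖ ≤ ‖H‖ ≤ e^S ‖w‖`. Along a circle on which `w ≠ 0`, two
applications of Rouché (`H_t ∘ γ → H ∘ γ` uniformly, `‖h ∘ γ - H_t ∘ γ‖ → 0`) and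
`wind (h ∘ γ) = wind (w ∘ γ)` (the factor `e^{-s ∘ γ}` is the exponential of a periodic function)
give `wind (w ∘ γ) = wind (H ∘ γ)`; the argument principle for `H`
(`ArgumentPrincipleWinding.lean`) does the rest.

Provenance: the device and the helpers were first written for the crux `TameOrBrodyR4` of summit
`SmoothPoincare4` (`Theorems/SullivanDualTameOrBrodyR4HelperLocalZeroIsolatedPositive.lean`,
conclusion `wind ≠ 0` on small circles); re-homed here (promotion event 3639839) with the comparison
form and positivity as the primary statements — steps W3 of the Literature proof of
`Literature.Geometry.Symplectic.jHolomorphicLimitOfEmbedded_isEmbedded` (McDuff 1991, positivity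
of intersections).

## References

* C. Wendl, *Lectures on Contact 3-Manifolds, Holomorphic Curves and Intersection Theory* (2020),
  App. B, Thm B.20, Cor B.21. [Wendl2020]
* D. McDuff, D. Salamon, *J-holomorphic curves and symplectic topology*, 2nd ed. (2012), §2.3.
  [McDuffSalamon2012]
-/

noncomputable section

open scoped ContDiff ComplexConjugate Topology
open Filter Set Metric
open Literature.Topology.PlaneTopology

namespace Literature.Analysis.Complex

open Similarity

/-- **Similarity principle, comparison form** (Carleman–Bers–Vekua; Wendl 2020, Thm B.20). Let
`w : ℂ → ℂ` be smooth with `∂̄ w = r` and `‖r‖ ≤ M ‖w‖` on `‖z‖ ≤ ρ`, and let `0 < ρ' < ρ`. Then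
there are `S : ℝ` and `H` holomorphic on `‖z‖ < ρ'` such that
`e^{-S} ‖w z‖ ≤ ‖H z‖ ≤ e^{S} ‖w z‖` for `‖z‖ < ρ'`, and `wind (w ∘ γ) = wind (H ∘ γ)` along every
circle `γ : ‖z - z₀‖ = ε` with `‖z₀‖ + ε < ρ'` on which `w` has no zero.
[cite: Wendl2020, App. B Thm B.20 and Cor B.21 (similarity principle)] -/
theorem similarity_comparison (w r : ℂ → ℂ) (M ρ ρ' : ℝ) (hρ' : 0 < ρ') (hρ : ρ' < ρ)
    (hw : ContDiff ℝ ∞ w) (hr : ContDiff ℝ ∞ r)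
    (hdbar : ∀ η : ℂ, dbarAlong 1 w η = r η)
    (hbound : ∀ η : ℂ, ‖η‖ ≤ ρ → ‖r η‖ ≤ M * ‖w η‖) :
    ∃ (S : ℝ) (H : ℂ → ℂ), DifferentiableOn ℂ H (ball 0 ρ') ∧
      (∀ z : ℂ, ‖z‖ < ρ' → Real.exp (-S) * ‖w z‖ ≤ ‖H z‖ ∧ ‖H z‖ ≤ Real.exp S * ‖w z‖) ∧
      ∀ (z₀ : ℂ) (ε : ℝ), 0 < ε → ‖z₀‖ + ε < ρ' → (∀ z : ℂ, ‖z - z₀‖ = ε → w z ≠ 0) →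
        wind (fun t => w (circleLoop z₀ ε t)) = wind (fun t => H (circleLoop z₀ ε t)) := by
  -- the degenerate case `w ≡ 0` on `‖z‖ < ρ'`: take `H = 0`
  by_cases hne : ∃ z : ℂ, ‖z‖ ≤ ρ ∧ w z ≠ 0
  swap
  · push Not at hne
    refine ⟨0, 0, differentiableOn_const 0, fun z hz => ?_, fun z₀ ε hε hz₀ε hw0 => ?_⟩
    · simp [hne z (by linarith)]
    · exact absurd (hne (z₀ + ε) (by
        have := norm_add_le z₀ (ε : ℂ)
        rw [Complex.norm_real, Real.norm_of_nonneg hε.le] at this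
        linarith)) (hw0 (z₀ + ε) (by simp [hε.le]))
  obtain ⟨z₁, hz₁, h1⟩ := hne
  -- `0 ≤ M`, tested at the point `z₁` where `w ≠ 0`
  have hM : 0 ≤ M :=
    nonneg_of_mul_nonneg_left ((norm_nonneg _).trans (hbound z₁ hz₁)) (norm_pos_iff.2 h1)
  -- the regularised family along `t = 1 / (n + 1)` and its holomorphic approximations
  obtain ⟨S, A, B, s, Hn, hA0, hs, hsS, hH, happ, hB⟩ :=
    exists_approx_seq hM hρ' hρ hw hr hdbar hbound
  -- Montel: a locally uniformly convergent subsequence with holomorphic limit `Hlim`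
  obtain ⟨Hlim, φ, hφ, hHlim, hloc, -⟩ :=
    Complex.exists_strictMono_tendstoLocallyUniformlyOn_of_norm_le isOpen_ball hH hB
  -- the errors along the subsequence tend to `0`
  set e : ℕ → ℝ := fun k => A * (1 / ((φ k : ℝ) + 1)) with he_def
  have he : Tendsto e atTop (𝓝 0) := by
    have h1 : Tendsto (fun k => 1 / ((φ k : ℝ) + 1)) atTop (𝓝 0) :=
      (tendsto_one_div_add_atTop_nhds_zero_nat (𝕜 := ℝ)).comp hφ.tendsto_atTop
    have h2 := h1.const_mul A
    rwa [mul_zero] at h2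
  -- the two-sided comparison `e^{-S} ‖w‖ ≤ ‖Hlim‖ ≤ e^S ‖w‖` on the disc `‖z‖ < ρ'`
  have hcomp : ∀ z : ℂ, ‖z‖ < ρ' →
      Real.exp (-S) * ‖w z‖ ≤ ‖Hlim z‖ ∧ ‖Hlim z‖ ≤ Real.exp S * ‖w z‖ := by
    intro z hz
    refine norm_le_of_tendsto (v := fun k => Complex.exp (-s (φ k) z) * w z)
      (hloc.tendsto_at (mem_ball_zero_iff.2 hz)) he (fun k => happ (φ k) z hz.le)
      (fun k => ?_) (fun k => ?_)
    · rw [norm_mul]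
      exact mul_le_mul_of_nonneg_right (exp_neg_le_norm_exp_neg (hsS _ z (by linarith)))
        (norm_nonneg _)
    · rw [norm_mul]
      exact mul_le_mul_of_nonneg_right (norm_exp_neg_le (hsS _ z (by linarith))) (norm_nonneg _)
  refine ⟨S, Hlim, hHlim, hcomp, fun z₀ ε hε hz₀ε hw0 => ?_⟩
  -- winding numbers along a circle on which `w` (hence `Hlim`) has no zero
  have hH0 : ∀ z : ℂ, ‖z - z₀‖ = ε → Hlim z ≠ 0 := fun z hz hH => by
    have hzρ : ‖z‖ < ρ' := by
      have := norm_le_insert' z z₀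
      linarith
    have h2 := (hcomp z hzρ).1
    rw [hH, norm_zero] at h2
    have h3 : 0 < Real.exp (-S) * ‖w z‖ := mul_pos (Real.exp_pos _) (norm_pos_iff.2 (hw0 z hz))
    linarith
  exact wind_eq_of_approx hε hz₀ε hw.continuous (fun k => (hs (φ k)).continuous) hHlim hloc
    (fun k z hz => happ (φ k) z hz) he hw0 hH0

/-- **Similarity principle: positivity of the index.** Under the hypotheses of
`similarity_comparison` (`∂̄ w = r`, `‖r‖ ≤ M ‖w‖` on `‖z‖ ≤ ρ`), if `w z₀ = 0` and `w` has no
zero on a circle `‖z - z₀‖ = ε` with `‖z₀‖ + ε < ρ`, then the winding number of `w` along that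
circle is strictly positive (it equals the number of zeros, with multiplicity, of the holomorphic
comparison function inside the circle). [cite: Wendl2020, App. B Thm B.20 and Cor B.21 (similarity principle)] -/
theorem similarity_wind_pos (w r : ℂ → ℂ) (M ρ : ℝ) (hw : ContDiff ℝ ∞ w) (hr : ContDiff ℝ ∞ r)
    (hdbar : ∀ η : ℂ, dbarAlong 1 w η = r η)
    (hbound : ∀ η : ℂ, ‖η‖ ≤ ρ → ‖r η‖ ≤ M * ‖w η‖)
    {z₀ : ℂ} {ε : ℝ} (hε : 0 < ε) (hz₀ε : ‖z₀‖ + ε < ρ) (h0 : w z₀ = 0)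
    (hw0 : ∀ z : ℂ, ‖z - z₀‖ = ε → w z ≠ 0) :
    0 < wind (fun t => w (circleLoop z₀ ε t)) := by
  -- an intermediate radius `‖z₀‖ + ε < ρ' < ρ`
  obtain ⟨ρ', hρ'₁, hρ'₂⟩ : ∃ ρ' : ℝ, ‖z₀‖ + ε < ρ' ∧ ρ' < ρ :=
    ⟨(‖z₀‖ + ε + ρ) / 2, by linarith, by linarith⟩
  have hρ'0 : 0 < ρ' := by linarith [norm_nonneg z₀]
  obtain ⟨S, H, hH, hcomp, hwind⟩ :=
    similarity_comparison w r M ρ ρ' hρ'0 hρ'₂ hw hr hdbar hbound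
  rw [hwind z₀ ε hε hρ'₁ hw0]
  -- `H` vanishes at `z₀`, is zero-free on the circle, and is holomorphic on `B(z₀, ρ' - ‖z₀‖)`
  have hH0 : H z₀ = 0 := by
    have := (hcomp z₀ (by linarith)).2
    rw [h0, norm_zero, mul_zero] at this
    exact norm_le_zero_iff.1 this
  have hHne : ∀ u : ℂ, ‖u - z₀‖ = ε → H u ≠ 0 := fun u hu hHu => by
    have huρ : ‖u‖ < ρ' := by
      have := norm_le_insert' u z₀
      linarith
    have h2 := (hcomp u huρ).1
    rw [hHu, norm_zero] at h2
    have h3 : 0 < Real.exp (-S) * ‖w u‖ := mul_pos (Real.exp_pos _) (norm_pos_iff.2 (hw0 u hu))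
    linarith
  have hHball : DifferentiableOn ℂ H (ball z₀ (ρ' - ‖z₀‖)) :=
    hH.mono fun u hu => by
      rw [mem_ball, dist_eq_norm] at hu
      rw [mem_ball_zero_iff]
      have := norm_le_insert' u z₀
      linarith
  exact wind_circleLoop_pos_of_zero_of_center H hε (by linarith) hHball (η₀ := z₀)
    (by simpa using hε) hH0 hHne

/-- **Similarity principle: non-negativity of the index along any zero-free circle.** Under the
hypotheses of `similarity_comparison`, the winding number of `w` along a circle `‖z - z₀‖ = ε`
(`‖z₀‖ + ε < ρ`) on which `w` has no zero is `≥ 0`. [cite: Wendl2020, App. B Thm B.20 and Cor B.21 (similarity principle)] -/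
theorem similarity_wind_nonneg (w r : ℂ → ℂ) (M ρ : ℝ) (hw : ContDiff ℝ ∞ w)
    (hr : ContDiff ℝ ∞ r) (hdbar : ∀ η : ℂ, dbarAlong 1 w η = r η)
    (hbound : ∀ η : ℂ, ‖η‖ ≤ ρ → ‖r η‖ ≤ M * ‖w η‖)
    {z₀ : ℂ} {ε : ℝ} (hε : 0 < ε) (hz₀ε : ‖z₀‖ + ε < ρ)
    (hw0 : ∀ z : ℂ, ‖z - z₀‖ = ε → w z ≠ 0) :
    0 ≤ wind (fun t => w (circleLoop z₀ ε t)) := by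
  obtain ⟨ρ', hρ'₁, hρ'₂⟩ : ∃ ρ' : ℝ, ‖z₀‖ + ε < ρ' ∧ ρ' < ρ :=
    ⟨(‖z₀‖ + ε + ρ) / 2, by linarith, by linarith⟩
  have hρ'0 : 0 < ρ' := by linarith [norm_nonneg z₀]
  obtain ⟨S, H, hH, hcomp, hwind⟩ :=
    similarity_comparison w r M ρ ρ' hρ'0 hρ'₂ hw hr hdbar hbound
  rw [hwind z₀ ε hε hρ'₁ hw0]
  have hHne : ∀ u : ℂ, ‖u - z₀‖ = ε → H u ≠ 0 := fun u hu hHu => by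
    have huρ : ‖u‖ < ρ' := by
      have := norm_le_insert' u z₀
      linarith
    have h2 := (hcomp u huρ).1
    rw [hHu, norm_zero] at h2
    have h3 : 0 < Real.exp (-S) * ‖w u‖ := mul_pos (Real.exp_pos _) (norm_pos_iff.2 (hw0 u hu))
    linarith
  -- translate to the origin and apply the argument principle (non-negativity)
  have key : ∀ t, circleLoop 0 ε t + z₀ = circleLoop z₀ ε t := fun t => by
    rw [circleLoop_apply, circleLoop_apply]
    ring
  have hH₀ : DifferentiableOn ℂ (fun z => H (z + z₀)) (ball 0 (ρ' - ‖z₀‖)) :=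
    hH.comp (differentiableOn_id.add_const z₀) fun z hz => by
      rw [mem_ball_zero_iff] at hz ⊢
      calc ‖z + z₀‖ ≤ ‖z‖ + ‖z₀‖ := norm_add_le _ _
        _ < ρ' := by linarith
  have h := wind_circleLoop_nonneg (fun z => H (z + z₀)) hε (by linarith) hH₀
    (fun u hu => hHne (u + z₀) (by simpa using hu))
  simpa only [key] using h

/-- **Similarity principle: isolated zeros of positive index.** A smooth `w` with `∂̄ w = r`,
`‖r‖ ≤ M ‖w‖` on the disc `‖z‖ ≤ ρ`, vanishing at an interior point `z₀` but not identically on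
the open disc, has a small zero-free punctured closed disc `0 < ‖z - z₀‖ ≤ ε` about `z₀`
(`‖z₀‖ + ε < ρ`), and its winding number along the circle `‖z - z₀‖ = ε` is `> 0`.
[cite: Wendl2020, App. B Thm B.20 and Cor B.21 (similarity principle)] -/
theorem similarity_isolated_zero (w r : ℂ → ℂ) (M ρ : ℝ)
    (hw : ContDiff ℝ ∞ w) (hr : ContDiff ℝ ∞ r)
    (hdbar : ∀ η : ℂ, dbarAlong 1 w η = r η)
    (hbound : ∀ η : ℂ, ‖η‖ ≤ ρ → ‖r η‖ ≤ M * ‖w η‖)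
    (z₀ : ℂ) (hz₀ : ‖z₀‖ < ρ) (h0 : w z₀ = 0) (hne : ∃ z : ℂ, ‖z‖ < ρ ∧ w z ≠ 0) :
    ∃ ε : ℝ, 0 < ε ∧ ‖z₀‖ + ε < ρ ∧
      (∀ z : ℂ, 0 < ‖z - z₀‖ → ‖z - z₀‖ ≤ ε → w z ≠ 0) ∧
      0 < wind (fun t => w (circleLoop z₀ ε t)) := by
  obtain ⟨z₁, hz₁, h1⟩ := hne
  -- radii `max ‖z₀‖ ‖z₁‖ < ρ' < ρ`
  obtain ⟨ρ', hz₀', hz₁', hρ'⟩ : ∃ ρ' : ℝ, ‖z₀‖ < ρ' ∧ ‖z₁‖ < ρ' ∧ ρ' < ρ :=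
    ⟨(max ‖z₀‖ ‖z₁‖ + ρ) / 2, by have := le_max_left ‖z₀‖ ‖z₁‖; linarith [max_lt hz₀ hz₁],
      by have := le_max_right ‖z₀‖ ‖z₁‖; linarith [max_lt hz₀ hz₁], by linarith [max_lt hz₀ hz₁]⟩
  have hρ'0 : 0 < ρ' := (norm_nonneg _).trans_lt hz₀'
  obtain ⟨S, H, hH, hcomp, -⟩ := similarity_comparison w r M ρ ρ' hρ'0 hρ' hw hr hdbar hbound
  have hH0 : H z₀ = 0 := by
    have := (hcomp z₀ hz₀').2
    rw [h0, norm_zero, mul_zero] at this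
    exact norm_le_zero_iff.1 this
  have hH1 : H z₁ ≠ 0 := fun h => by
    have h2 := (hcomp z₁ hz₁').1
    rw [h, norm_zero] at h2
    have h3 : 0 < Real.exp (-S) * ‖w z₁‖ := mul_pos (Real.exp_pos _) (norm_pos_iff.2 h1)
    linarith
  -- the zero-free punctured disc of `H`, hence of `w`
  obtain ⟨ε, hε, hε', hHne⟩ := exists_radius hH hz₀' hz₁' hH1
  have hwne : ∀ z : ℂ, 0 < ‖z - z₀‖ → ‖z - z₀‖ ≤ ε → w z ≠ 0 := fun z hz1 hz2 hwz => by
    have hz : ‖z‖ < ρ' := by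
      have := norm_le_insert' z z₀
      linarith
    have h2 := (hcomp z hz).2
    rw [hwz, norm_zero, mul_zero] at h2
    exact hHne z hz1 hz2 (norm_le_zero_iff.1 h2)
  refine ⟨ε, hε, by linarith, hwne, ?_⟩
  exact similarity_wind_pos w r M ρ hw hr hdbar hbound hε (by linarith) h0 fun z hz =>
    hwne z (by rw [hz]; exact hε) hz.le

end Literature.Analysis.Complex

end
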